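/-
Origin: expansion seat `planner-pub-hodgecm-mc-unitary-1-g7-0`, handover #5 r3 2026-08-19T22:44Z md5 3c3dfacbac19 (NEW additive KERNEL leaf; model1 (R1″)/(W-guard) W side: the FIELD-LEVEL guarded record `wmInputCM₂g` (= `wmInputCM₂` minus the `hρ`/`hδ` binders, `ρ := ρg` = honest Weil action under the sign fact / `1` otherwise, majorants discharged from the guard; Type fields unguarded ⇒ junction statements type-check definitionally) + read-backs + (x-W) K-type exports under the sign fact + `WGuard` sign-fact-from-GoodCtx lemmas; installs after the RUN-36 rows WmInstanceV2KType / WmInputTrivial / GramWRegime / ThetaModel (all installed); nothing imports it; drop alone) (`HOME/mc/pub-hodgecm-mc-unitary-1-g7/work/pkg/HodgeCM/Model/WmInputInstance.lean`, md5 3c3dfacb, 358 lines);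
landed by the gen-13 packager (p-g13) in gate run 37 as `HodgeCM/Model/WmInputInstance.lean` (verbatim).
-/
/-
Origin: speedrun cell pub-hodgecm, MODEL-CONSTRUCTION sub-cell, lineage mc-unitary-1 (node W2-Kn «K-norm» / E binder `W`, BINDER-OWNERS §1a row 4),
seat planner-pub-hodgecm-mc-unitary-1-g7-0 (gen 7), 2026-08-19.  NEW additive KERNEL leaf `HodgeCM/Model/WmInputInstance.lean` (RUN 37+;
install after the RUN-36 rows `Model/WmInstanceV2.lean`, `Model/WmInstanceV2KType.lean`; nothing installed imports it — binder-1's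
`Binders/Gen12Pins*` (RUN 37, `Gen12Pins.W`) and through it E's assembly are its consumers).  Implements model1-g8's TYPE RULING
(R1″) = binder-1-g9's (W-guard) 2026-08-19T22:14:14Z / 22:15:26Z for the W pin: the END-STATE corollary keeps ONLY inhabitable pin-input
families as variables; the context-dependent W-sign fact (binder-1's former universal W-sign binder) is absorbed INSIDE the record AT FIELD LEVEL — the Type/structure-valued
fields `F ι GU ΓU G Γ SK eV eW` stay UNGUARDED (so `(W V c).F ≡ L⁺`, `(W V c).ι ≡ Fin 6`, … remain DEFINITIONAL and the row-14/16/17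
junction statements `τ := tau12 V c.D : piSchwartzBruhat (W V c).F (W V c).ι`, `Ψ ∈ (W V c).SK`, … type-check), ONLY the value field `ρ`
is an `ite` on the sign condition (honest `(ω_ψ ∘ (s_pair ⊗ η)).toHomUnits`, fallback `1`) and the proof fields `hρ hrat SK_stable` are by
cases; the dead orientation (δ) binder of `wmInputCM₂` and its majorant binder are GONE (Weil's majorants are DISCHARGED in the
honest branch from the sign facts of `HermSpace3` by the vendored `Weil1964.hasThetaMajorants_cmPairSplitting_of_signs_two`).
A whole-record `dite` (my first cut, and model1's (R1′) sketch) is NOT usable: `(if h then r₁ else r₂).F` is a stuck `Decidable.rec`.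
KERNEL only: 0 records of published theorems, 0 `def … : Prop`, nothing cited, no placeholder proof; MODEL-N ±0.  Nothing here is a
claim of the manuscripts under adjudication.

CONTENTS (ns `HodgeCM.Model` unless stated)
§1 `hρ_of_dW_definite V S hGR (h)` — Weil's theta majorants for the pair splitting from the sign fact `h :` «the W-plane `⟨a₀, a₁⟩` of `S`
   is definite at `ι₁`» `(∀ j, 0 < (ι₁ (dW S j)).re) ∨ ∀ j, (ι₁ (dW S j)).re < 0` (+ `frameD_sign_ι₁'`, `frameD_sign_of_ne`, `Model/WmInstanceV2`
   §Signs); `ρg V S hGR η := if h : ⟨sign fact⟩ then (cmPairRepTwist … hGR η).toHomUnits else 1` — THE GUARDED WEIL ACTION — with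
   `ρg_eq_of (h)` (`if_pos`), `ρg_eq_one_of (¬h)` (`if_neg`), `hasThetaMajorants_ρg`, `ρg_mem_thetaStabilizer`, `ρg_stable` (each by cases:
   honest = the `wmInputCM₂` field term, fallback = the constant-`1` facts of `Model/WmInputTrivial`).
§2 **`wmInputCM₂g V S hGR η hη hηc τ T hT : WmInput V S`** — the generic-`η` record `wmInputCM₂` (RUN 36) with `ρ := ρg V S hGR η` and NO
   majorant / orientation (δ) / W-sign binders; every other field is `wmInputCM₂`'s term.  Read-backs: `wmInputCM₂g_ρ` (`= ρg …`, rfl),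
   **`wmInputCM₂g_ρ_eq_of (h) : (wmInputCM₂g …).ρ = (cmPairRepTwist … hGR η).toHomUnits`**, `wmInputCM₂g_ρ_eq_one_of`, `wmInputCM₂g_SK` (rfl),
   `wmInputCM₂g_eV_archIsotropyRegime` (rfl; `gK := archIsotropyRegime`, `Model/WmInstanceV2KType`), and the (x-W) K-type exports UNDER THE
   SIGN FACT: **`wmInputCM₂g_mem_SK_iff hV … (h)`**, **`wmInputCM₂g_hSK hV … (h)`** (binder-1's `hSK` verbatim at `Kι := K_∞`,
   `gK := archIsotropyRegime`, `χ := archKappa`) — proved from the tree lemma `mem_cmKTypeTwist_iff` after ONE `rw [wmInputCM₂g_ρ_eq_of … h]`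
   (lineage rules R1/R2).  binder-1 COMPATIBILITY: `wmInputCM₂g` (same signature), `wmInputCM₂g_ρ_of` (= `_ρ_eq_of`), `wmInputCM₂g_ρ_apply_of`,
   `wmInputCM₂g_F/_ι/_eV/_eW` (rfl) and the binder order `… τ T hT hV h` of `_mem_SK_iff/_hSK` are binder-1's `Binders/WmInputGuarded` (2105fa760e7c)
   spellings, so its `Gen12Pins.Wg / Wg_ρ_of / Wg_hSK` block elaborates over THIS leaf with only the import changed (its `abbrev PlaneDefinite S` =
   this sign fact, reducibly; `PlaneDefinite` and `Gen12Pins.*` stay binder-1's — not declared here).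
§3 ns `HodgeCM.Model.WGuard`: the sign fact READ OFF a good context — `dW_definite_of_re_pos_iff`, **`dW_definite_of_goodCtx (h : Bool)
   (hc : SignRecipe.GoodCtx h ι₁ c)`** (binder-1 (J-hW) `SignRecipe.re_pos_iff_of_goodCtx`, `Binders/GramWRegime`, installed),
   **`dW_definite_of_thetaModel_goodCtx (C : U.AdelicThetaCore hP) h d12 d34 (hc : (C.thetaModel h d12 d34).GoodCtx ι₁ c)`** (the END-STATE
   guard of ANY core, in particular E's `(pinT … W S μ).GoodCtx ι₁ c`).  Same statements as sinst-1's `ArchSideTerm.dW_definite_*`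
   (`Model/ThetaAdelicSideInstance`, RUN 37) — ONE proof of the disjunction serves the S `dite` and the W field guard; duplicated here only
   because neither RUN-37 leaf may import the other.  Conveniences at `S := c.D`: `wmInputCM₂g_ρ_eq_of_goodCtx`, `wmInputCM₂g_ρ_eq_of_thetaModel_goodCtx`.
PIN OF RECORD (model1 (R1″)): `W := Gen12Pins.W @hGR @η @hη @hηc @τSyl @TSyl @hTSyl` with binder-1's
`Gen12Pins.W … := fun V c => wmInputCM₂g V c.D (hGR V c) (η V c) (hη V c) (hηc V c) (τSyl V c) (TSyl V c) (hTSyl V c)` — seven families, each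
inhabited at every `(V, c)`.
ELABORATION NOTE (lineage rule R2, re-measured on this leaf): a unification of two applications of the record that are not SYNTACTICALLY
equal (a `_` placeholder under the record) runs into `whnf` at 200000 heartbeats — pass all arguments explicitly; consumers re-prove a
`ρ`-dependent field by `rw [wmInputCM₂g_ρ_eq_of … hW]` FIRST (`hW := WGuard.dW_definite_of_thetaModel_goodCtx … hc`), after which the
remaining projections are `rfl`.
-/
import Summits.HodgeConjecture.HodgeCM.Model.WmInstanceV2KType
import Summits.HodgeConjecture.HodgeCM.Model.WmInputTrivial
import Summits.HodgeConjecture.HodgeCM.Automorphic.ThetaModel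
import Summits.HodgeConjecture.HodgeCM.Model.Binders.GramWRegime

-- G11b-3 recipe (port D30 slow-export class; ops-buildfix LEDGER B13-1/B13-3): elaborate sequentially so the trailing
-- `attribute [implicit_reducible]` block (reducibilityCoreExt is keyed to the async environment branch) is in force at `.olean` export.
set_option Elab.async false

set_option autoImplicit false

noncomputable section

namespace HodgeCM.Model

open HodgeCM.Adelic Literature.NumberTheory.Weil1964 Literature.NumberTheory.Automorphic NumberField
open Literature.NumberTheory.GelbartRogawski1991.UnitaryDualPair
open Literature.RepresentationTheory.HeisenbergGroup
open scoped Matrix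

variable {L : CMField} {ι₁ : L →+* ℂ}

/-! ## §1 the guarded Weil action -/
section Guarded

variable (V : HermSpace3 L ι₁) (S : StubTree.SeesawDatum L)
  (hGR : (cmSplittingDatum (L : Type) finProdFinEquiv (frameD V) (frameD_real V) (frameD_ne V) (dW S) (dW_real S) (dW_ne S)).CompatibleSplitting)
  (η : CMAdelic (L : Type) (frameD V) × CMAdelic (L : Type) (dW S) →* ℂˣ)
  (hη : ∀ γU ∈ CMRat (L : Type) (frameD V), ∀ γ ∈ CMRat (L : Type) (dW S), η (γU, γ) = 1)
  (hηc : Continuous fun p => ((η p : ℂˣ) : ℂ))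

/-- **Weil's theta majorants for the pair splitting, DISCHARGED** from the sign fact at `ι₁` and the `V`-side sign facts of `HermSpace3`
(vendored `Weil1964.hasThetaMajorants_cmPairSplitting_of_signs_two`; exactly the `hρ` fed to `wmInputCM₂` inside `wmInputCM₂s'`). -/
theorem hρ_of_dW_definite (h : (∀ j, 0 < (ι₁ (dW S j)).re) ∨ ∀ j, (ι₁ (dW S j)).re < 0) :
    HasThetaMajorants fun (p : CMAdelic (L : Type) (frameD V) × CMAdelic (L : Type) (dW S)) (Φ : CMSchwartz (L : Type) 6) =>
      adelicMpCont.omega (↥(maximalRealSubfield L)) (Fin 6)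
        (CMGram (L : Type) finProdFinEquiv (frameD V) (frameD_real V) (dW S) (dW_real S))
        (cmPairSplitting (L : Type) finProdFinEquiv (frameD V) (frameD_real V) (frameD_ne V) (dW S) (dW_real S) (dW_ne S) hGR p) Φ :=
  hasThetaMajorants_cmPairSplitting_of_signs_two (L : Type) finProdFinEquiv (frameD V) (frameD_real V) (frameD_ne V) (dW S)
    (dW_real S) (dW_ne S) ι₁ hGR (frameD_sign_ι₁' V) h (frameD_sign_of_ne V)

open scoped Classical in
/-- **the GUARDED normalised Weil action** `ρg`: `(ω_ψ ∘ (s_pair ⊗ η)).toHomUnits` when the W-plane `⟨a₀, a₁⟩` of `S` is definite at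
`ι₁` (always the case at a good context, §3), the trivial homomorphism `1` otherwise (never evaluated by E). -/
def ρg : CMAdelic (L : Type) (frameD V) × CMAdelic (L : Type) (dW S) →* (Module.End ℂ (CMSchwartz (L : Type) 6))ˣ :=
  if (∀ j, 0 < (ι₁ (dW S j)).re) ∨ ∀ j, (ι₁ (dW S j)).re < 0 then
    (cmPairRepTwist (L : Type) finProdFinEquiv (frameD V) (frameD_real V) (frameD_ne V) (dW S) (dW_real S) (dW_ne S) hGR η).toHomUnits
  else 1

/-- (R2) value-level read-back, honest branch. -/
theorem ρg_eq_of (h : (∀ j, 0 < (ι₁ (dW S j)).re) ∨ ∀ j, (ι₁ (dW S j)).re < 0) :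
    ρg V S hGR η =
      (cmPairRepTwist (L : Type) finProdFinEquiv (frameD V) (frameD_real V) (frameD_ne V) (dW S) (dW_real S) (dW_ne S) hGR η).toHomUnits :=
  if_pos h

/-- (R2) value-level read-back, fallback branch. -/
theorem ρg_eq_one_of (h : ¬ ((∀ j, 0 < (ι₁ (dW S j)).re) ∨ ∀ j, (ι₁ (dW S j)).re < 0)) : ρg V S hGR η = 1 :=
  if_neg h

include hηc in
/-- Weil's theta majorants for `ρg` (honest: `hasThetaMajorants_cmPairRepTwist` on the discharged pair majorants; fallback: the constant
family, `hasThetaMajorants_const`). -/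
theorem hasThetaMajorants_ρg :
    HasThetaMajorants fun (g : CMAdelic (L : Type) (frameD V) × CMAdelic (L : Type) (dW S)) (Φ : CMSchwartz (L : Type) 6) =>
      (ρg V S hGR η g : Module.End ℂ (CMSchwartz (L : Type) 6)) Φ := by
  by_cases h : (∀ j, 0 < (ι₁ (dW S j)).re) ∨ ∀ j, (ι₁ (dW S j)).re < 0
  · rw [ρg_eq_of V S hGR η h]
    exact hasThetaMajorants_cmPairRepTwist (L : Type) finProdFinEquiv (frameD V) (frameD_real V) (frameD_ne V) (dW S) (dW_real S)
      (dW_ne S) hGR η (hρ_of_dW_definite V S hGR h) hηc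
  · rw [ρg_eq_one_of V S hGR η h]
    simpa using hasThetaMajorants_const (↥(maximalRealSubfield L)) (Fin 6) (CMAdelic (L : Type) (frameD V) × CMAdelic (L : Type) (dW S))

include hη in
/-- `Θ`-invariance on rational points for `ρg` (honest: Weil Thm 6 + [GR91 (3.1.1)] at the twisted pair action; fallback: `one_mem`). -/
theorem ρg_mem_thetaStabilizer :
    ∀ γU ∈ CMRat (L : Type) (frameD V), ∀ γ ∈ CMRat (L : Type) (dW S),
      ρg V S hGR η (γU, γ) ∈ thetaStabilizer (↥(maximalRealSubfield L)) (Fin 6) := by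
  intro γU hU γ hγ
  by_cases h : (∀ j, 0 < (ι₁ (dW S j)).re) ∨ ∀ j, (ι₁ (dW S j)).re < 0
  · rw [ρg_eq_of V S hGR η h]
    exact cmPairRepTwist_toHomUnits_mem_thetaStabilizer (L : Type) finProdFinEquiv (frameD V) (frameD_real V) (frameD_ne V) (dW S)
      (dW_real S) (dW_ne S) hGR η hη hU hγ
  · rw [ρg_eq_one_of V S hGR η h, MonoidHom.one_apply]
    exact one_mem _

/-- the twisted `κ`-isotypic `K`-type is stable under `ρg (1, ·)` (honest: `cmKTypeTwist_stable`; fallback: `ρg = 1` acts trivially). -/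
theorem ρg_stable (τ : L →+* ℂ) (T : GL (Fin 3) ℂ)
    (hT : formCongr (starRingEnd ℂ) T (V.Hm.map τ) = Literature.Geometry.ComplexHyperbolic.BallModel.J) :
    ∀ (g : CMAdelic (L : Type) (dW S)) (Φ : CMSchwartz (L : Type) 6),
      Φ ∈ (cmKTypeTwist (L : Type) finProdFinEquiv (frameD V) (frameD_real V) (frameD_ne V) (dW S) (dW_real S) (dW_ne S) hGR η V.Hm
              (frameG V) (frame_congr V) τ T hT (UnitaryGroup.archKappa (L : Type) V.Hm τ T hT) : Set (CMSchwartz (L : Type) 6)) →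
        (ρg V S hGR η (1, g) : Module.End ℂ (CMSchwartz (L : Type) 6)) Φ ∈
          (cmKTypeTwist (L : Type) finProdFinEquiv (frameD V) (frameD_real V) (frameD_ne V) (dW S) (dW_real S) (dW_ne S) hGR η V.Hm
              (frameG V) (frame_congr V) τ T hT (UnitaryGroup.archKappa (L : Type) V.Hm τ T hT) : Set (CMSchwartz (L : Type) 6)) := by
  intro g Φ hΦ
  by_cases h : (∀ j, 0 < (ι₁ (dW S j)).re) ∨ ∀ j, (ι₁ (dW S j)).re < 0
  · rw [ρg_eq_of V S hGR η h]
    exact cmKTypeTwist_stable (L : Type) finProdFinEquiv (frameD V) (frameD_real V) (frameD_ne V) (dW S) (dW_real S) (dW_ne S) hGR η V.Hm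
      (frameG V) (frame_congr V) τ T hT _ g Φ hΦ
  · rw [ρg_eq_one_of V S hGR η h, MonoidHom.one_apply, Units.val_one]
    simpa using hΦ

/-! ## §2 the record with the field-level guard -/

/-- **the bundled input record of `wm V c`, v2 (K-norm), generic twist character `η`, FIELD-LEVEL GUARD** (model1 (R1″)):
`wmInputCM₂` with `ρ := ρg V S hGR η` and no majorant / orientation (δ) / W-sign binders; all Type/structure fields unguarded and unchanged. -/
def wmInputCM₂g (τ : L →+* ℂ) (T : GL (Fin 3) ℂ)
    (hT : formCongr (starRingEnd ℂ) T (V.Hm.map τ) = Literature.Geometry.ComplexHyperbolic.BallModel.J) : WmInput V S where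
  F := ↥(maximalRealSubfield L)
  ι := Fin 6
  GU := CMAdelic (L : Type) (frameD V)
  ΓU := CMRat (L : Type) (frameD V)
  G := CMAdelic (L : Type) (dW S)
  Γ := CMRat (L : Type) (dW S)
  ρ := ρg V S hGR η
  hρ := hasThetaMajorants_ρg V S hGR η hηc
  hrat := ρg_mem_thetaStabilizer V S hGR η hη
  SK := (cmKTypeTwist (L : Type) finProdFinEquiv (frameD V) (frameD_real V) (frameD_ne V) (dW S) (dW_real S) (dW_ne S) hGR η V.Hm (frameG V) (frame_congr V) τ T hT
          (UnitaryGroup.archKappa (L : Type) V.Hm τ T hT) : Set (CMSchwartz (L : Type) 6))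
  SK_stable := ρg_stable V S hGR η τ T hT
  SK_zero := (cmKTypeTwist (L : Type) finProdFinEquiv (frameD V) (frameD_real V) (frameD_ne V) (dW S) (dW_real S) (dW_ne S) hGR η V.Hm (frameG V) (frame_congr V) τ T hT _).zero_mem
  SK_add := fun hΦ hΨ =>
    (cmKTypeTwist (L : Type) finProdFinEquiv (frameD V) (frameD_real V) (frameD_ne V) (dW S) (dW_real S) (dW_ne S) hGR η V.Hm (frameG V) (frame_congr V) τ T hT _).add_mem hΦ hΨ
  SK_smul := fun a _ hΦ =>
    (cmKTypeTwist (L : Type) finProdFinEquiv (frameD V) (frameD_real V) (frameD_ne V) (dW S) (dW_real S) (dW_ne S) hGR η V.Hm (frameG V) (frame_congr V) τ T hT _).smul_mem a hΦ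
  eV := (cmFrameEquiv (L : Type) (frameG V) V.Hm (frameD V) (frame_congr V)).toMonoidHom
  heV := continuous_cmFrameEquiv (L : Type) (frameG V) V.Hm (frameD V) (frame_congr V)
  hΓV := fun _ h => cmFrameEquiv_mem_range_toAdelic (L : Type) (frameG V) V.Hm (frameD V) (frame_congr V) h
  eW := (cmAdelicEquiv (L : Type) 2 (Matrix.diagonal (dW S))).toMonoidHom
  heW := (cmAdelicEquiv (L : Type) 2 (Matrix.diagonal (dW S))).continuous
  hΓW := fun _ h => cmAdelicEquiv_mem_range_toAdelic (L : Type) 2 (Matrix.diagonal (dW S)) h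

/-- the `ρ` field IS the guarded action (definitional). -/
theorem wmInputCM₂g_ρ (τ : L →+* ℂ) (T : GL (Fin 3) ℂ)
    (hT : formCongr (starRingEnd ℂ) T (V.Hm.map τ) = Literature.Geometry.ComplexHyperbolic.BallModel.J) :
    (wmInputCM₂g V S hGR η hη hηc τ T hT).ρ = ρg V S hGR η := rfl

/-- **(R2) the ONE value-level read-back consumers need**: under the sign fact the `ρ` field is `(ω_ψ ∘ (s_pair ⊗ η)).toHomUnits`
(an equation in a FIXED type — `F ι GU G` are unguarded). -/
theorem wmInputCM₂g_ρ_eq_of (τ : L →+* ℂ) (T : GL (Fin 3) ℂ)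
    (hT : formCongr (starRingEnd ℂ) T (V.Hm.map τ) = Literature.Geometry.ComplexHyperbolic.BallModel.J)
    (h : (∀ j, 0 < (ι₁ (dW S j)).re) ∨ ∀ j, (ι₁ (dW S j)).re < 0) :
    (wmInputCM₂g V S hGR η hη hηc τ T hT).ρ =
      (cmPairRepTwist (L : Type) finProdFinEquiv (frameD V) (frameD_real V) (frameD_ne V) (dW S) (dW_real S) (dW_ne S) hGR η).toHomUnits :=
  (wmInputCM₂g_ρ V S hGR η hη hηc τ T hT).trans (ρg_eq_of V S hGR η h)

/-- … and off the sign fact it is `1`. -/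
theorem wmInputCM₂g_ρ_eq_one_of (τ : L →+* ℂ) (T : GL (Fin 3) ℂ)
    (hT : formCongr (starRingEnd ℂ) T (V.Hm.map τ) = Literature.Geometry.ComplexHyperbolic.BallModel.J)
    (h : ¬ ((∀ j, 0 < (ι₁ (dW S j)).re) ∨ ∀ j, (ι₁ (dW S j)).re < 0)) :
    (wmInputCM₂g V S hGR η hη hηc τ T hT).ρ = 1 :=
  (wmInputCM₂g_ρ V S hGR η hη hηc τ T hT).trans (ρg_eq_one_of V S hGR η h)

/-- binder-1's spelling of `wmInputCM₂g_ρ_eq_of` (its `Binders/WmInputGuarded` API; same statement and binder order). -/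
theorem wmInputCM₂g_ρ_of (τ : L →+* ℂ) (T : GL (Fin 3) ℂ)
    (hT : formCongr (starRingEnd ℂ) T (V.Hm.map τ) = Literature.Geometry.ComplexHyperbolic.BallModel.J)
    (h : (∀ j, 0 < (ι₁ (dW S j)).re) ∨ ∀ j, (ι₁ (dW S j)).re < 0) :
    (wmInputCM₂g V S hGR η hη hηc τ T hT).ρ =
      (cmPairRepTwist (L : Type) finProdFinEquiv (frameD V) (frameD_real V) (frameD_ne V) (dW S) (dW_real S) (dW_ne S) hGR η).toHomUnits :=
  wmInputCM₂g_ρ_eq_of V S hGR η hη hηc τ T hT h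

/-- operator form of the guarded read-back (binder-1's `wmInputCM₂g_ρ_apply_of`). -/
theorem wmInputCM₂g_ρ_apply_of (τ : L →+* ℂ) (T : GL (Fin 3) ℂ)
    (hT : formCongr (starRingEnd ℂ) T (V.Hm.map τ) = Literature.Geometry.ComplexHyperbolic.BallModel.J)
    (h : (∀ j, 0 < (ι₁ (dW S j)).re) ∨ ∀ j, (ι₁ (dW S j)).re < 0)
    (x : CMAdelic (L : Type) (frameD V) × CMAdelic (L : Type) (dW S)) (Ψ : CMSchwartz (L : Type) 6) :
    ((wmInputCM₂g V S hGR η hη hηc τ T hT).ρ x :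
        Module.End ℂ (piSchwartzBruhat (wmInputCM₂g V S hGR η hη hηc τ T hT).F (wmInputCM₂g V S hGR η hη hηc τ T hT).ι)) Ψ =
      cmPairRepTwist (L : Type) finProdFinEquiv (frameD V) (frameD_real V) (frameD_ne V) (dW S) (dW_real S) (dW_ne S) hGR η x Ψ := by
  rw [wmInputCM₂g_ρ_eq_of V S hGR η hη hηc τ T hT h]
  rfl

/-- the Type fields are DEFINITIONAL (the (W-guard) point): `F = L⁺`. -/
theorem wmInputCM₂g_F (τ : L →+* ℂ) (T : GL (Fin 3) ℂ)
    (hT : formCongr (starRingEnd ℂ) T (V.Hm.map τ) = Literature.Geometry.ComplexHyperbolic.BallModel.J) :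
    (wmInputCM₂g V S hGR η hη hηc τ T hT).F = ↥(maximalRealSubfield L) := rfl

/-- … `ι = Fin 6`. -/
theorem wmInputCM₂g_ι (τ : L →+* ℂ) (T : GL (Fin 3) ℂ)
    (hT : formCongr (starRingEnd ℂ) T (V.Hm.map τ) = Literature.Geometry.ComplexHyperbolic.BallModel.J) :
    (wmInputCM₂g V S hGR η hη hηc τ T hT).ι = Fin 6 := rfl

/-- … `eV` = the rational-frame currency `cmFrameEquiv`. -/
theorem wmInputCM₂g_eV (τ : L →+* ℂ) (T : GL (Fin 3) ℂ)
    (hT : formCongr (starRingEnd ℂ) T (V.Hm.map τ) = Literature.Geometry.ComplexHyperbolic.BallModel.J) :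
    (wmInputCM₂g V S hGR η hη hηc τ T hT).eV = (cmFrameEquiv (L : Type) (frameG V) V.Hm (frameD V) (frame_congr V)).toMonoidHom := rfl

/-- … `eW` = `cmAdelicEquiv` at `diag(a₀, a₁)`. -/
theorem wmInputCM₂g_eW (τ : L →+* ℂ) (T : GL (Fin 3) ℂ)
    (hT : formCongr (starRingEnd ℂ) T (V.Hm.map τ) = Literature.Geometry.ComplexHyperbolic.BallModel.J) :
    (wmInputCM₂g V S hGR η hη hηc τ T hT).eW = (cmAdelicEquiv (L : Type) 2 (Matrix.diagonal (dW S))).toMonoidHom := rfl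

/-- the `SK` field: the twisted `κ`-isotypic `K`-type at `χ := archKappa` (definitional, unguarded). -/
theorem wmInputCM₂g_SK (τ : L →+* ℂ) (T : GL (Fin 3) ℂ)
    (hT : formCongr (starRingEnd ℂ) T (V.Hm.map τ) = Literature.Geometry.ComplexHyperbolic.BallModel.J) :
    (wmInputCM₂g V S hGR η hη hηc τ T hT).SK =
      (cmKTypeTwist (L : Type) finProdFinEquiv (frameD V) (frameD_real V) (frameD_ne V) (dW S) (dW_real S) (dW_ne S) hGR η V.Hm (frameG V) (frame_congr V) τ T hT
          (UnitaryGroup.archKappa (L : Type) V.Hm τ T hT) : Set (CMSchwartz (L : Type) 6)) := rfl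

/-- along `K_∞` the record's `eV ∘ gK` is the tree's `cmKTypeHom` in the rational frame of record (definitional; `gK := archIsotropyRegime`). -/
theorem wmInputCM₂g_eV_archIsotropyRegime (τ : L →+* ℂ) (T : GL (Fin 3) ℂ)
    (hT : formCongr (starRingEnd ℂ) T (V.Hm.map τ) = Literature.Geometry.ComplexHyperbolic.BallModel.J)
    (hV : IsAnisotropic L V.Hm) (k : ↥(UnitaryGroup.archIsotropy (L : Type) V.Hm τ T hT)) :
    (wmInputCM₂g V S hGR η hη hηc τ T hT).eV
        (archIsotropyRegime V hV τ T hT k : ↥(Adelic.adelicUnitaryGroup L V.Hm)) =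
      cmKTypeHom (L : Type) V.Hm (frameG V) (frameD V) (frame_congr V) (UnitaryGroup.archIsotropyToAdelic (L : Type) V.Hm τ T hT k) :=
  rfl

/-- **membership in `SK`** ↔ `K_∞`-eigen for `archKappa` through the record's OWN action `ρ ∘ (eV ∘ gK, 1)`, UNDER THE SIGN FACT
(tree `mem_cmKTypeTwist_iff`, after `rw [wmInputCM₂g_ρ_eq_of … h]`); binder order `… τ T hT hV h` = binder-1's. -/
theorem wmInputCM₂g_mem_SK_iff (τ : L →+* ℂ) (T : GL (Fin 3) ℂ)
    (hT : formCongr (starRingEnd ℂ) T (V.Hm.map τ) = Literature.Geometry.ComplexHyperbolic.BallModel.J)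
    (hV : IsAnisotropic L V.Hm) (h : (∀ j, 0 < (ι₁ (dW S j)).re) ∨ ∀ j, (ι₁ (dW S j)).re < 0)
    (Ψ : piSchwartzBruhat (wmInputCM₂g V S hGR η hη hηc τ T hT).F (wmInputCM₂g V S hGR η hη hηc τ T hT).ι) :
    Ψ ∈ (wmInputCM₂g V S hGR η hη hηc τ T hT).SK ↔
      ∀ k : ↥(UnitaryGroup.archIsotropy (L : Type) V.Hm τ T hT),
        (((wmInputCM₂g V S hGR η hη hηc τ T hT).ρ
            ((wmInputCM₂g V S hGR η hη hηc τ T hT).eV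
              (archIsotropyRegime V hV τ T hT k : ↥(Adelic.adelicUnitaryGroup L V.Hm)), 1)) :
            Module.End ℂ (piSchwartzBruhat (wmInputCM₂g V S hGR η hη hηc τ T hT).F
              (wmInputCM₂g V S hGR η hη hηc τ T hT).ι)) Ψ =
          ((UnitaryGroup.archKappa (L : Type) V.Hm τ T hT k : ℂˣ) : ℂ) • Ψ := by
  rw [wmInputCM₂g_ρ_eq_of V S hGR η hη hηc τ T hT h]
  exact mem_cmKTypeTwist_iff (L : Type) finProdFinEquiv (frameD V) (frameD_real V) (frameD_ne V) (dW S) (dW_real S) (dW_ne S) hGR η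
    V.Hm (frameG V) (frame_congr V) τ T hT (UnitaryGroup.archKappa (L : Type) V.Hm τ T hT) Ψ

/-- **(x-W) at `wmInputCM₂g` UNDER THE SIGN FACT** — binder-1's `hSK` verbatim (`Kι := K_∞`, `gK := archIsotropyRegime`, `χ := archKappa`);
binder order `… τ T hT hV h` = binder-1's `Binders/WmInputGuarded` spelling, so its `Gen12Pins.Wg_hSK` body elaborates over this leaf unchanged. -/
theorem wmInputCM₂g_hSK (τ : L →+* ℂ) (T : GL (Fin 3) ℂ)
    (hT : formCongr (starRingEnd ℂ) T (V.Hm.map τ) = Literature.Geometry.ComplexHyperbolic.BallModel.J)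
    (hV : IsAnisotropic L V.Hm) (h : (∀ j, 0 < (ι₁ (dW S j)).re) ∨ ∀ j, (ι₁ (dW S j)).re < 0) :
    ∀ Ψ : piSchwartzBruhat (wmInputCM₂g V S hGR η hη hηc τ T hT).F (wmInputCM₂g V S hGR η hη hηc τ T hT).ι,
      (∀ k : ↥(UnitaryGroup.archIsotropy (L : Type) V.Hm τ T hT),
        (((wmInputCM₂g V S hGR η hη hηc τ T hT).ρ
            ((wmInputCM₂g V S hGR η hη hηc τ T hT).eV
              (archIsotropyRegime V hV τ T hT k : ↥(Adelic.adelicUnitaryGroup L V.Hm)), 1)) :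
            Module.End ℂ (piSchwartzBruhat (wmInputCM₂g V S hGR η hη hηc τ T hT).F
              (wmInputCM₂g V S hGR η hη hηc τ T hT).ι)) Ψ =
          ((UnitaryGroup.archKappa (L : Type) V.Hm τ T hT k : ℂˣ) : ℂ) • Ψ) →
      Ψ ∈ (wmInputCM₂g V S hGR η hη hηc τ T hT).SK :=
  fun Ψ hΨ => (wmInputCM₂g_mem_SK_iff V S hGR η hη hηc τ T hT hV h Ψ).2 hΨ

end Guarded

/-! ## §3 the sign fact read off a good context -/
namespace WGuard

section Guard

variable (ι₁) (c : SeesawCtx L)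

/-- the W-plane `⟨a₀, a₁⟩` is definite at `ι₁` from the common-sign statement `0 < Re ι₁(a₀) ↔ 0 < Re ι₁(a₁)`
(the discriminants are nonzero reals at every embedding: `SignRecipe.re_embedding_a_ne_zero`, binder-1 `Binders/GramWRegime`). -/
theorem dW_definite_of_re_pos_iff (hs : 0 < (ι₁ (c.D.a 0)).re ↔ 0 < (ι₁ (c.D.a 1)).re) :
    (∀ j, 0 < (ι₁ (dW c.D j)).re) ∨ ∀ j, (ι₁ (dW c.D j)).re < 0 := by
  by_cases h0 : 0 < (ι₁ (c.D.a 0)).re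
  · refine Or.inl fun j => ?_
    fin_cases j
    · exact h0
    · exact hs.mp h0
  · have h0' : (ι₁ (c.D.a 0)).re < 0 := lt_of_le_of_ne (not_lt.mp h0) (SignRecipe.re_embedding_a_ne_zero c ι₁ 0)
    have h1' : (ι₁ (c.D.a 1)).re < 0 :=
      lt_of_le_of_ne (not_lt.mp fun h1 => h0 (hs.mpr h1)) (SignRecipe.re_embedding_a_ne_zero c ι₁ 1)
    refine Or.inr fun j => ?_
    fin_cases j
    · exact h0'
    · exact h1'

/-- **the sign fact at a good context** (PerL's model-free recipe guard, any sign bit `h`; binder-1's (J-hW)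
`SignRecipe.re_pos_iff_of_goodCtx`: forced signs + `σ ∈ Ψ_i` ⇒ all four lines have the same sign at `ι₁`). -/
theorem dW_definite_of_goodCtx (h : Bool) (hc : SignRecipe.GoodCtx h ι₁ c) :
    (∀ j, 0 < (ι₁ (dW c.D j)).re) ∨ ∀ j, (ι₁ (dW c.D j)).re < 0 :=
  dW_definite_of_re_pos_iff ι₁ c (SignRecipe.re_pos_iff_of_goodCtx hc 0 1)

/-- **the sign fact at a good context of the END STATE of ANY core** — in particular at E's `(pinT … W S μ).GoodCtx ι₁ c`. -/
theorem dW_definite_of_thetaModel_goodCtx {U : Universe} {hP : PrintFact_unitaryCompact} (C : U.AdelicThetaCore hP) (h : Bool)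
    (d12 d34 : ∀ {L : CMField}, SeesawCtx L → Universe.SideData L) (hc : (C.thetaModel h d12 d34).GoodCtx ι₁ c) :
    (∀ j, 0 < (ι₁ (dW c.D j)).re) ∨ ∀ j, (ι₁ (dW c.D j)).re < 0 :=
  dW_definite_of_goodCtx ι₁ c h ((C.thetaModel_goodCtx_iff h d12 d34 ι₁ c).mp hc)

end Guard

end WGuard

/-! ### conveniences at `S := c.D` -/
section Ctx

variable (V : HermSpace3 L ι₁) (c : SeesawCtx L)
  (hGR : (cmSplittingDatum (L : Type) finProdFinEquiv (frameD V) (frameD_real V) (frameD_ne V) (dW c.D) (dW_real c.D)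
    (dW_ne c.D)).CompatibleSplitting)
  (η : CMAdelic (L : Type) (frameD V) × CMAdelic (L : Type) (dW c.D) →* ℂˣ)
  (hη : ∀ γU ∈ CMRat (L : Type) (frameD V), ∀ γ ∈ CMRat (L : Type) (dW c.D), η (γU, γ) = 1)
  (hηc : Continuous fun p => ((η p : ℂˣ) : ℂ))
  (τ : L →+* ℂ) (T : GL (Fin 3) ℂ)
  (hT : formCongr (starRingEnd ℂ) T (V.Hm.map τ) = Literature.Geometry.ComplexHyperbolic.BallModel.J)

/-- **at a good context the record's action IS the honest one** (recipe guard, any sign bit). -/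
theorem wmInputCM₂g_ρ_eq_of_goodCtx (h : Bool) (hc : SignRecipe.GoodCtx h ι₁ c) :
    (wmInputCM₂g V c.D hGR η hη hηc τ T hT).ρ =
      (cmPairRepTwist (L : Type) finProdFinEquiv (frameD V) (frameD_real V) (frameD_ne V) (dW c.D) (dW_real c.D) (dW_ne c.D)
        hGR η).toHomUnits :=
  wmInputCM₂g_ρ_eq_of V c.D hGR η hη hηc τ T hT (WGuard.dW_definite_of_goodCtx ι₁ c h hc)

/-- … and under the guard of the END STATE of any core (E's `(pinT … W S μ).GoodCtx ι₁ c` by `pinT_eq_thetaModel`). -/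
theorem wmInputCM₂g_ρ_eq_of_thetaModel_goodCtx {U : Universe} {hP : PrintFact_unitaryCompact} (C : U.AdelicThetaCore hP) (h : Bool)
    (d12 d34 : ∀ {L : CMField}, SeesawCtx L → Universe.SideData L) (hc : (C.thetaModel h d12 d34).GoodCtx ι₁ c) :
    (wmInputCM₂g V c.D hGR η hη hηc τ T hT).ρ =
      (cmPairRepTwist (L : Type) finProdFinEquiv (frameD V) (frameD_real V) (frameD_ne V) (dW c.D) (dW_real c.D) (dW_ne c.D)
        hGR η).toHomUnits :=
  wmInputCM₂g_ρ_eq_of V c.D hGR η hη hηc τ T hT (WGuard.dW_definite_of_thetaModel_goodCtx ι₁ c C h d12 d34 hc)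

end Ctx


end HodgeCM.Model

end
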